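import Mathlib
import Summits.ValiantsHypothesis.ValiantsHypothesis.Theorems.BorderApolarityFixedWitnessObstructionQPSocleMax
import Literature.Computability.AlgebraicComplexity.ApolarityAction

/-!
# Border apolarity, crux `ToricWitnessObstructionQP` (stmt-ValiantsHypothesis-14753) — line `Sketch`,
# reshape 4: stub `stub_socleMaxRel` (the extremal socle step with the scalar and the shift exported)

Route `ValiantsHypothesis/BorderApolarity`, crux item `stmt-ValiantsHypothesis-14753`
(`Summit.ValiantsHypothesis.ValiantsHypothesis.Theses.BorderApolarity.ToricWitnessObstructionQP`),
line `Sketch`, reshape 4, stub `stub_socleMaxRel`.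

Along the toric curve `Q_t = u · diag((t+2)^w) · g · det_m` (`w : variables → ℤ`), the limsup
clause W3 in degree `m` (every subsequential coefficientwise limit of degree-`m` annihilators of the
`Q_{φ t}` lies in `J m`) and W5 in degree `m` (`J m ⌟ pp = 0` for the padded permanent
`pp = X₀₀^{m-n} per_n`) force `pp = u · wHC_{w₁}^e (μ • g · det_m)` with `μ ≠ 0`, the ℕ-valued
shifted weights `w₁ = w - c` for `c = min w`, and `e` an upper bound of (in fact the maximum of) the
`w₁`-weights of the monomials of `g · det_m` (extremality).

This is the landed extremal socle step `SocleMax.exists_eq_weightedHomogeneousComponent_max`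
(`…BorderApolarityFixedWitnessObstructionQPSocleMax`) with the translate `u` kept and the scalar
`μ` and the shift `c` exported instead of being repackaged into a new orbit element; the proof is
the same: with `F = g · det_m`, `e₀ = max_{d ∈ supp F} ⟨w,d⟩` and the top component `F₀`,
`(t+2)^{-e₀} Q_t → u · F₀` coefficientwise (`Socle.tendsto_coeffVec_torus`),
`Ann_m(u · F₀) ⊆ J m ⊆ Ann_m(pp)` (`Socle.mem_of_apolarAction_limit_eq_zero`, W3, W5), so
`pp = μ • u · F₀` (`Socle.exists_eq_smul_of_apolar_imp`) with `μ ≠ 0`, and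
`F₀ = wHC_{w₁}^{e}(F)` for `w₁ = w - min w ≥ 0`, `e = e₀ - m · min w` (`F` is a form of degree
`m`); extremality holds because `e₀` was chosen maximal and the shift is monotone.
Sources: Buczyńska–Buczyński 2021 Thm 1 (necessity half, socle degree); Landsberg 2017 §6.7.
-/

open MvPolynomial Filter
open scoped BigOperators Matrix
open Literature.Computability.AlgebraicComplexity

-- the mandated summit-side namespace repeats a component by design (single-problem summit)
set_option linter.dupNamespace false

namespace Summit.ValiantsHypothesis.ValiantsHypothesis.Theorems.BorderApolarityToricWitnessObstructionQP

open Summit.ValiantsHypothesis.ValiantsHypothesis.Theorems.BorderApolarityFixedWitnessObstructionQP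

/-- **Stub 1 — extremal socle step with relations.**  Along the toric curve
`Q_t = u · diag((t+2)^w) · g · det_m`, W3 and W5 at `k = m` force
`pp = u · wHC_{w₁}^e (μ • g · det_m)` with `μ ≠ 0`, `w₁ = w − c` (`c = min w`) ℕ-valued and `e` the top
`w₁`-weight of `g · det_m` (extremal).  Same proof as the landed `stub_socleMax`
(`…FixedWitnessObstructionQPSocleMax.lean`), keeping `u` and exporting `μ`, `c`.
Sources: Buczyńska–Buczyński 2021 Thm 1 (necessity half, socle degree); Landsberg 2017 §6.7.
[folklore] -/
theorem stub_socleMaxRel : ∀ (n m : ℕ) [NeZero m], n ≤ m →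
    ∀ (J : ℕ → Set (MvPolynomial (Fin m × Fin m) ℂ)) (u g : GL (Fin m × Fin m) ℂ)
      (w : Fin m × Fin m → ℤ),
    (∀ (D : MvPolynomial (Fin m × Fin m) ℂ) (φ : ℕ → ℕ) (Ds : ℕ → MvPolynomial (Fin m × Fin m) ℂ),
      StrictMono φ →
      (∀ t, (Ds t).IsHomogeneous m ∧ apolarAction (Ds t)
        (linSubst (Fin m × Fin m) ℂ (u : Matrix (Fin m × Fin m) (Fin m × Fin m) ℂ)
          (linSubst (Fin m × Fin m) ℂ (Matrix.diagonal fun i : Fin m × Fin m => ((φ t : ℂ) + 2) ^ (w i))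
            (linSubst (Fin m × Fin m) ℂ (g : Matrix (Fin m × Fin m) (Fin m × Fin m) ℂ)
              (detPoly (Fin m) ℂ)))) = 0) →
      Tendsto (fun t => coeffVec (Ds t)) atTop (nhds (coeffVec D)) → D ∈ J m) →
    (∀ D ∈ J m, apolarAction D (paddedPerPoly ℂ n m) = 0) →
    ∃ (μ : ℂ) (c : ℤ) (e : ℕ), μ ≠ 0 ∧ (∀ i, c ≤ w i) ∧
      (∀ d ∈ (linSubst (Fin m × Fin m) ℂ (g : Matrix (Fin m × Fin m) (Fin m × Fin m) ℂ)
        (detPoly (Fin m) ℂ)).support, Finsupp.weight (fun i => (w i - c).toNat) d ≤ e) ∧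
      paddedPerPoly ℂ n m = linSubst (Fin m × Fin m) ℂ (u : Matrix (Fin m × Fin m) (Fin m × Fin m) ℂ)
        (weightedHomogeneousComponent (fun i => (w i - c).toNat) e
          (μ • linSubst (Fin m × Fin m) ℂ (g : Matrix (Fin m × Fin m) (Fin m × Fin m) ℂ)
            (detPoly (Fin m) ℂ))) := by
  intro n m _ hnm J u g w hW3 hW5
  -- the toric curve `Q t = u · diag((t+2)^w) · g · det_m`; the hypothesis W3 is about `Q (φ t)`
  set Q : ℕ → MvPolynomial (Fin m × Fin m) ℂ := fun t => linSubst (Fin m × Fin m) ℂ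
    (u : Matrix (Fin m × Fin m) (Fin m × Fin m) ℂ)
    (linSubst (Fin m × Fin m) ℂ (Matrix.diagonal fun i : Fin m × Fin m => ((t : ℂ) + 2) ^ (w i))
      (linSubst (Fin m × Fin m) ℂ (g : Matrix (Fin m × Fin m) (Fin m × Fin m) ℂ)
        (detPoly (Fin m) ℂ))) with hQ
  have hW3' : ∀ (D : MvPolynomial (Fin m × Fin m) ℂ) (φ : ℕ → ℕ)
      (Ds : ℕ → MvPolynomial (Fin m × Fin m) ℂ), StrictMono φ →
      (∀ t, (Ds t).IsHomogeneous m ∧ apolarAction (Ds t) (Q (φ t)) = 0) →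
      Tendsto (fun t => coeffVec (Ds t)) atTop (nhds (coeffVec D)) → D ∈ J m := hW3
  -- `F = g · det_m`: a nonzero form of degree `m` in the orbit of `det_m`
  set F : MvPolynomial (Fin m × Fin m) ℂ := linSubst (Fin m × Fin m) ℂ
    (g : Matrix (Fin m × Fin m) (Fin m × Fin m) ℂ) (detPoly (Fin m) ℂ) with hF
  have hForb : F ∈ glOrbit (Fin m × Fin m) ℂ (detPoly (Fin m) ℂ) := ⟨g, linSubstRep_apply _ _ g _⟩
  have hFne : F ≠ 0 := BorderApolarity.ne_zero_of_mem_glOrbit_detPoly hForb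
  have hFhom : F.IsHomogeneous m := by
    simpa [Fintype.card_fin] using BorderApolarity.isHomogeneous_of_mem_glOrbit_detPoly hForb
  have hdeg : ∀ d ∈ F.support, ∑ i ∈ d.support, (d i : ℤ) = m := fun d hd => by
    have h : d.degree = m := by
      rw [Finsupp.degree_eq_weight_one]; exact hFhom (mem_support_iff.1 hd)
    rw [Finsupp.degree_apply] at h
    exact_mod_cast h
  -- the top weight `e₀` (MAXIMAL on the support) and the top weight component `F₀ ≠ 0` of `F`
  obtain ⟨d₀, hd₀, hmax⟩ := Finset.exists_max_image F.support (Finsupp.weight w)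
    (support_nonempty.2 hFne)
  set e₀ : ℤ := Finsupp.weight w d₀ with he₀
  set F₀ : MvPolynomial (Fin m × Fin m) ℂ := ∑ d ∈ F.support,
    monomial d (if Finsupp.weight w d = e₀ then coeff d F else 0) with hF₀
  have hF₀coeff : ∀ d, coeff d F₀ =
      if Finsupp.weight w d = e₀ then coeff d F else 0 := by
    intro d
    rw [hF₀, coeff_sum, Finset.sum_eq_single d (fun e _ hne => by rw [coeff_monomial, if_neg hne])
      (fun hd => by rw [coeff_monomial, if_pos rfl, notMem_support_iff.1 hd, ite_self]),
      coeff_monomial, if_pos rfl]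
  have hF₀ne : F₀ ≠ 0 := by
    intro h
    have h0 := hF₀coeff d₀
    rw [h, coeff_zero, if_pos rfl] at h0
    exact (mem_support_iff.1 hd₀) h0.symm
  have hF₀hom : F₀.IsHomogeneous m := by
    intro d hd
    rw [hF₀coeff] at hd
    split_ifs at hd with h
    · exact hFhom hd
    · exact absurd rfl hd
  -- the limit direction `Q_∞ = u · F₀ ≠ 0`, a form of degree `m`
  have hQinfne : linSubst (Fin m × Fin m) ℂ (u : Matrix (Fin m × Fin m) (Fin m × Fin m) ℂ) F₀ ≠ 0 :=
    fun h => hF₀ne (linSubst_injective_of_isUnit_det _ (Matrix.isUnits_det_units u)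
      (h.trans (map_zero _).symm))
  have hQinfhom : (linSubst (Fin m × Fin m) ℂ (u : Matrix (Fin m × Fin m) (Fin m × Fin m) ℂ)
      F₀).IsHomogeneous m := linSubst_isHomogeneous _ hF₀hom
  have hQhom : ∀ t, (Q t).IsHomogeneous m := fun t => by
    rw [hQ]; exact linSubst_isHomogeneous _ (linSubst_isHomogeneous _ hFhom)
  -- `(t+2)^{-e₀} • Q t → Q_∞` coefficientwise
  have hlim : Tendsto (fun t : ℕ => coeffVec ((((t : ℂ) + 2) ^ (-e₀)) • Q t)) atTop
      (nhds (coeffVec (linSubst (Fin m × Fin m) ℂ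
        (u : Matrix (Fin m × Fin m) (Fin m × Fin m) ℂ) F₀))) := by
    simp_rw [hQ]
    exact Socle.tendsto_coeffVec_torus _ F w hmax
  -- `Ann_m(Q_∞) ⊆ J m ⊆ Ann_m(pp)`, so `pp = μ • Q_∞` with `μ ≠ 0`
  have key : ∀ D : MvPolynomial (Fin m × Fin m) ℂ, D.IsHomogeneous m →
      apolarAction D (linSubst (Fin m × Fin m) ℂ
        (u : Matrix (Fin m × Fin m) (Fin m × Fin m) ℂ) F₀) = 0 → D ∈ J m :=
    fun D hD hDQ => Socle.mem_of_apolarAction_limit_eq_zero hQhom hW3'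
      (r := fun t : ℕ => ((t : ℂ) + 2) ^ (-e₀))
      (fun t => zpow_ne_zero _ (BorderApolarityToricFixedPoints.tli_natCast_add_two_ne_zero t))
      hQinfhom hQinfne hlim hD hDQ
  obtain ⟨μ, hμ⟩ := Socle.exists_eq_smul_of_apolar_imp hQinfhom hQinfne
    (paddedPerPoly_isHomogeneous (k := ℂ) hnm) fun D hD hDQ => hW5 D (key D hD hDQ)
  have hμne : μ ≠ 0 := by
    rintro rfl
    rw [zero_smul] at hμ
    exact BorderApolarity.paddedPerPoly_ne_zero n m hμ
  -- shift the weights by their minimum `c = w i₀` to make them ℕ-valued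
  obtain ⟨i₀, -, hi₀⟩ := Finset.exists_min_image (Finset.univ : Finset (Fin m × Fin m)) w
    Finset.univ_nonempty
  have hw' : ∀ i, (((w i - w i₀).toNat : ℕ) : ℤ) = w i - w i₀ := fun i =>
    Int.toNat_of_nonneg (sub_nonneg.2 (hi₀ i (Finset.mem_univ i)))
  have he₀ge : (m : ℤ) * w i₀ ≤ e₀ := by
    rw [he₀, Finsupp.weight_apply, Finsupp.sum]
    calc (m : ℤ) * w i₀ = ∑ i ∈ d₀.support, (d₀ i : ℤ) * w i₀ := by
          rw [← Finset.sum_mul, hdeg d₀ hd₀]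
      _ ≤ ∑ i ∈ d₀.support, d₀ i • w i := Finset.sum_le_sum fun i _ => by
          rw [nsmul_eq_mul]
          exact mul_le_mul_of_nonneg_left (hi₀ i (Finset.mem_univ i)) (Nat.cast_nonneg _)
  have he' : (((e₀ - m * w i₀).toNat : ℕ) : ℤ) = e₀ - m * w i₀ :=
    Int.toNat_of_nonneg (sub_nonneg.2 he₀ge)
  -- the shifted weight of a degree-`m` monomial is the old weight shifted by `m · min w`
  have hwt : ∀ d ∈ F.support, ((Finsupp.weight (fun i => (w i - w i₀).toNat) d : ℕ) : ℤ) =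
      Finsupp.weight w d - m * w i₀ := fun d hd => by
    rw [Finsupp.weight_apply, Finsupp.weight_apply, Finsupp.sum, Finsupp.sum]
    simp only [smul_eq_mul, nsmul_eq_mul, Nat.cast_sum, Nat.cast_mul, hw']
    rw [← hdeg d hd, Finset.sum_mul, ← Finset.sum_sub_distrib]
    exact Finset.sum_congr rfl fun i _ => by ring
  have hwhc : weightedHomogeneousComponent (fun i => (w i - w i₀).toNat) (e₀ - m * w i₀).toNat F =
      F₀ := by
    ext d
    rw [coeff_weightedHomogeneousComponent, hF₀coeff]
    by_cases hd : d ∈ F.support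
    · have hiff : Finsupp.weight (fun i => (w i - w i₀).toNat) d = (e₀ - m * w i₀).toNat ↔
          Finsupp.weight w d = e₀ := by
        rw [← Nat.cast_inj (R := ℤ), hwt d hd, he', sub_left_inj]
      by_cases h : Finsupp.weight w d = e₀
      · rw [if_pos h, if_pos (hiff.2 h)]
      · rw [if_neg h, if_neg (mt hiff.1 h)]
    · rw [notMem_support_iff.1 hd, ite_self, ite_self]
  refine ⟨μ, w i₀, (e₀ - m * w i₀).toNat, hμne, fun i => hi₀ i (Finset.mem_univ i), ?_, ?_⟩
  · -- extremality: on `supp F` one has `⟨w,d⟩ ≤ e₀` (`hmax`), and the shift is monotone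
    intro d hd
    rw [← Nat.cast_le (α := ℤ), hwt d hd, he']
    exact sub_le_sub_right (hmax d hd) _
  · -- representation: `u · wHC_{w₁}^{e}(μ • F) = μ • u · F₀ = pp`
    rw [map_smul, map_smul, hwhc]
    exact hμ

end Summit.ValiantsHypothesis.ValiantsHypothesis.Theorems.BorderApolarityToricWitnessObstructionQP
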